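import Summits.PneNP.PneNP.Theorems.ConvexRankGatesConvexGateBlindExactLiftingTriangleTwoLine
import Mathlib.LinearAlgebra.Matrix.Rank
import Mathlib.LinearAlgebra.FiniteDimensional.Basic

/-!
# Triangle instance — REGROUPING RIGIDITY, unconditionally: the lines are the only `≤ 3t²`-term non-negative
# factorisation of `M_t` with generators in `cone{1_L}` (`t ≥ 4`)

Support file for crux `ConvexGateBlind` (stmt-PneNP-10680), open stub `stub_exactLifting`; prover seat 0, session 36,
memo ANALYSIS15 §3. Last of four files (`…TriangleVertex`, `…TriangleVanishing`, `…TriangleTwoLine`). This removes the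
combinatorial hypothesis COV-rigidity(t) from `regroupingRigid_of_cov` (file `…TriangleRegroupingRigidityOfCov`): the LP /
covering route of ANALYSIS14 §5 is superseded by LINEAR ALGEBRA.

**Theorem (`regroupingRigid`).** Let `t ≥ 4`, `M_t = Σ_i u_i ⊗ g_i` with `u ≥ 0`, `g_i = Σ_L α_{iL} 1_L`, `α ≥ 0`, indexed by a
finite type `ι`. Then `#ι ≥ 3t²` (`card_ge`); and if `#ι ≤ 3t²` there is a bijection `σ : ι ≃ Line t` with
`α_{iL} > 0 ⟺ L = σ i` — every generator is a positive multiple of its own line, each line once.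

Proof. On nondegenerate rows `Σ_i u_i(x) α_{iL} = [L mono_x]` (`regrouping_coeff`): `N = U·A`. Apply the biorthogonal
functionals `Φ_{L₀}` of `…TriangleVertex` (they only read four nondegenerate rows): `B·A = 1` with `B_{L₀ i} := Φ_{L₀}(u_i)/2`
(`bmat_mul_amat`), so `3t² = rank 1 ≤ rank A ≤ #ι`. If `#ι ≤ 3t²`, `A` is square and `A·B = 1` (`amat_mul_bmat`), whence
`u_j(x) = Σ_L B_{Lj} [L mono_x]` on nondegenerate rows (`usage_eq_lcomb`). By `regrouping_usage`, `u_j` vanishes on every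
nondegenerate row under which some line of `supp α_j` is bichromatic; so if `supp α_j` contained two lines, the two-line lemma
(`VanOn.eq_zero_of_two`) would force `B_{·j} = 0`, contradicting `(A·B)_{jj} = 1`; and `supp α_j ≠ ∅` for the same reason.
Distinct `j` have distinct lines (else `(A·B)_{ij} = 0` is violated), and counting finishes.
Also: the R1′-shaped conclusion for regroupings indexed by the lines (`lineGenRigid_of_regrouping`), and the registered
self-contained form `triangle_regrouping_rigidity` (= `triangle_regrouping_rigidity_of_cov` WITHOUT the COV hypothesis).
-/

set_option linter.dupNamespace false -- `Summit.PneNP.PneNP.…`: summit = sub-problem (D-0017)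

namespace Summit.PneNP.PneNP.Theorems.XorDoor.TriLine

open Finset

noncomputable section

variable {t : ℕ} {ι : Type} [Fintype ι] [DecidableEq ι]

/-! ## The matrices `A = (α_{iL})` and `B = (Φ_L(u_i)/2)` -/

/-- the generator matrix `A_{iL} = α_{iL}` -/
def amat (α : ι → Line t → ℝ) : Matrix ι (Line t) ℝ := fun i L => α i L

/-- the functional matrix `B_{L i} = Φ_L(u_i)/2` -/
def bmat (ht : 4 ≤ t) (u : ι → Col t → ℝ) : Matrix (Line t) ι ℝ := fun L i => lfun ht L (u i) / 2

section Fact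

variable (ht : 4 ≤ t) {u : ι → Col t → ℝ} (hu : ∀ i x, 0 ≤ u i x) {α : ι → Line t → ℝ} (hα : ∀ i L, 0 ≤ α i L)
  (hfact : ∀ x w, ∑ i, u i x * ∑ L, α i L * lind L w = (monoCount x w : ℝ))

include ht hu hα hfact

omit [DecidableEq ι] in
/-- **`B·A = 1`**: the functionals read `Σ_i u_i(·) α_{iL} = [L mono]` on their four nondegenerate rows. -/
theorem bmat_mul_amat : bmat ht u * amat α = 1 := by
  ext L₀ L
  rw [Matrix.mul_apply, Matrix.one_apply]
  have hcomb : lfun ht L₀ (fun y => ∑ i, α i L * u i y) = if L = L₀ then 2 else 0 := by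
    rw [← lfun_mInd ht L₀ L]
    refine lfun_congr ht L₀ fun x hx => ?_
    rw [← regrouping_coeff hx (fun i => hu i x) hα (hfact x) L]
    exact sum_congr rfl fun i _ => mul_comm _ _
  rw [lfun_sum] at hcomb
  calc ∑ i, bmat ht u L₀ i * amat α i L = (∑ i, α i L * lfun ht L₀ (u i)) / 2 := by
        rw [sum_div]; exact sum_congr rfl fun i _ => by simp only [bmat, amat]; ring
    _ = (if L₀ = L then 1 else 0) := by
        rw [hcomb]
        by_cases h : L₀ = L
        · rw [if_pos h, if_pos h.symm]; norm_num
        · rw [if_neg h, if_neg (Ne.symm h)]; norm_num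

omit [DecidableEq ι] in
/-- **The covering bound for free**: a regrouping of `M_t` has at least `3t²` generators (`t ≥ 4`). -/
theorem card_ge : 3 * t ^ 2 ≤ Fintype.card ι := by
  have h1 : (bmat ht u * amat α).rank = Fintype.card (Line t) := by
    rw [bmat_mul_amat ht hu hα hfact, Matrix.rank_one]
  have h2 : (bmat ht u * amat α).rank ≤ (amat α).rank := Matrix.rank_mul_le_right _ _
  have h3 : (amat α).rank ≤ Fintype.card ι := Matrix.rank_le_card_height _
  have hcardL : Fintype.card (Line t) = 3 * t ^ 2 := by
    simp only [Line, Fintype.card_sum, Fintype.card_prod, Fintype.card_fin]; ring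
  omega

/-- **`A·B = 1`** when `#ι ≤ 3t²` (square case). -/
theorem amat_mul_bmat (hι : Fintype.card ι ≤ 3 * t ^ 2) : amat α * bmat ht u = 1 := by
  have hcardL : Fintype.card (Line t) = 3 * t ^ 2 := by
    simp only [Line, Fintype.card_sum, Fintype.card_prod, Fintype.card_fin]; ring
  have hcard : Fintype.card ι = Fintype.card (Line t) := by
    rw [hcardL]; exact le_antisymm hι (card_ge ht hu hα hfact)
  exact (Matrix.mul_eq_one_comm_of_card_eq (A := amat α) (B := bmat ht u) (eq := hcard)).2 (bmat_mul_amat ht hu hα hfact)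

/-- **The usage functions are combinations of line patterns**: `u_j(x) = Σ_L B_{Lj} [L mono_x]` on nondegenerate rows. -/
theorem usage_eq_lcomb (hι : Fintype.card ι ≤ 3 * t ^ 2) {x : Col t} (hx : mu x ≠ 0) (j : ι) :
    u j x = lcomb (fun L => bmat ht u L j) x := by
  have hAB := amat_mul_bmat ht hu hα hfact hι
  unfold lcomb
  calc u j x = ∑ i, u i x * (amat α * bmat ht u) i j := by
        rw [hAB, Fintype.sum_eq_single j]
        · rw [Matrix.one_apply_eq, mul_one]
        · intro i hi; rw [Matrix.one_apply_ne hi, mul_zero]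
    _ = ∑ i, ∑ L, u i x * (amat α i L * bmat ht u L j) := by
        refine sum_congr rfl fun i _ => ?_
        rw [Matrix.mul_apply, mul_sum]
    _ = ∑ L, ∑ i, u i x * (amat α i L * bmat ht u L j) := sum_comm
    _ = ∑ L, bmat ht u L j * mInd x L := by
        refine sum_congr rfl fun L _ => ?_
        rw [← regrouping_coeff hx (fun i => hu i x) hα (hfact x) L, mul_sum]
        exact sum_congr rfl fun i _ => by simp only [amat]; ring

/-- **A line of `supp α_j` annihilates**: `u_j`, i.e. `ψ_{B_{·j}}`, vanishes on the nondegenerate rows under which a line with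
`α_{jK} > 0` is bichromatic (`regrouping_usage`). -/
theorem vanOn_col (hι : Fintype.card ι ≤ 3 * t ^ 2) {j : ι} {K : Line t} (hK : 0 < α j K) :
    VanOn (fun L => bmat ht u L j) K := by
  intro x hx hKb
  rw [← usage_eq_lcomb ht hu hα hfact hι hx j]
  rcases (hu j x).lt_or_eq with hpos | h0
  · exact absurd (regrouping_usage hx (fun i => hu i x) hα (hfact x) hpos hK) hKb
  · exact h0.symm

/-- **Every generator is supported on exactly one line.** -/
theorem supp_unique (hι : Fintype.card ι ≤ 3 * t ^ 2) (j : ι) : ∃ K, 0 < α j K ∧ ∀ K', 0 < α j K' → K' = K := by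
  classical
  have hAB := amat_mul_bmat ht hu hα hfact hι
  have hdiag : ∑ L, amat α j L * bmat ht u L j = 1 := by rw [← Matrix.mul_apply, hAB, Matrix.one_apply_eq]
  -- nonempty support
  obtain ⟨K, -, hK⟩ : ∃ K ∈ (univ : Finset (Line t)), amat α j K * bmat ht u K j ≠ 0 := by
    by_contra hno
    push Not at hno
    rw [sum_eq_zero hno] at hdiag
    exact zero_ne_one hdiag
  have hαK : 0 < α j K := by
    rcases (hα j K).lt_or_eq with h | h
    · exact h
    · exfalso; apply hK; simp only [amat]; rw [← h, zero_mul]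
  refine ⟨K, hαK, fun K' hK' => ?_⟩
  by_contra hne
  -- two lines in the support: the column `B_{·j}` vanishes identically, contradicting the diagonal entry
  have hzero : ∀ L, bmat ht u L j = 0 :=
    VanOn.eq_zero_of_two (vanOn_col ht hu hα hfact hι hK') (vanOn_col ht hu hα hfact hι hαK) ht hne
  rw [sum_eq_zero fun L _ => by rw [hzero L, mul_zero]] at hdiag
  exact zero_ne_one hdiag

/-- **REGROUPING RIGIDITY (unconditional).** For `t ≥ 4`: a non-negative factorisation `M_t = Σ_i u_i ⊗ (Σ_L α_{iL} 1_L)`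
with `#ι ≤ 3t²` generators in `cone{1_L}` has exactly `3t²` of them, and a bijection `σ : ι ≃ Line t` with
`α_{iL} > 0 ⟺ L = σ i`. -/
theorem regroupingRigid (hι : Fintype.card ι ≤ 3 * t ^ 2) :
    Fintype.card ι = 3 * t ^ 2 ∧ ∃ σ : ι ≃ Line t, ∀ i L, 0 < α i L ↔ L = σ i := by
  classical
  have hcardL : Fintype.card (Line t) = 3 * t ^ 2 := by
    simp only [Line, Fintype.card_sum, Fintype.card_prod, Fintype.card_fin]; ring
  have hcard : Fintype.card ι = 3 * t ^ 2 := le_antisymm hι (card_ge ht hu hα hfact)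
  refine ⟨hcard, ?_⟩
  choose f hf hfu using supp_unique ht hu hα hfact hι
  have hAB := amat_mul_bmat ht hu hα hfact hι
  -- `f` is injective: two generators on the same line would break `A·B = 1`
  have hinj : Function.Injective f := by
    intro i j hij
    by_contra hne
    have hoff : ∑ L, amat α i L * bmat ht u L j = 0 := by rw [← Matrix.mul_apply, hAB, Matrix.one_apply_ne hne]
    have hdiag : ∑ L, amat α j L * bmat ht u L j = 1 := by rw [← Matrix.mul_apply, hAB, Matrix.one_apply_eq]
    -- both sums reduce to their `f j` term
    have hsupp : ∀ k L, L ≠ f k → amat α k L = 0 := by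
      intro k L hL
      rcases (hα k L).lt_or_eq with h | h
      · exact absurd (hfu k L h) hL
      · exact h.symm
    rw [Fintype.sum_eq_single (f j) fun L hL => by rw [hsupp j L hL, zero_mul]] at hdiag
    rw [Fintype.sum_eq_single (f j) fun L hL => by rw [hsupp i L (hij ▸ hL), zero_mul]] at hoff
    have hB : bmat ht u (f j) j ≠ 0 := fun h => by rw [h, mul_zero] at hdiag; exact zero_ne_one hdiag
    have hαi : amat α i (f j) = 0 := by
      rcases mul_eq_zero.1 hoff with h | h
      · exact h
      · exact absurd h hB
    have : 0 < α i (f j) := hij ▸ hf i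
    simp only [amat] at hαi
    linarith
  have hbij : Function.Bijective f := by
    rw [Fintype.bijective_iff_injective_and_card]
    exact ⟨hinj, by rw [hcard, hcardL]⟩
  refine ⟨Equiv.ofBijective f hbij, fun i L => ?_⟩
  change 0 < α i L ↔ L = f i
  constructor
  · exact hfu i L
  · rintro rfl; exact hf i

end Fact

/-- **Generator rigidity (R1′ conclusion) for regroupings indexed by the lines**: if `M_t = Σ_L u_L ⊗ v_L` with `u ≥ 0` and
every `v_L` a non-negative combination of line indicators, then (for `t ≥ 4`) there are a permutation `σ` and `c ≥ 0` with
`u_L(x) v_L(w) = c_L(x)·1_{σ L}(w)` — the hypothesis `hR` of `jump_of_lineGenRigid` holds ON THE REGROUPING CLASS. -/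
theorem lineGenRigid_of_regrouping (ht : 4 ≤ t) {u : Line t → Col t → ℝ} (hu : ∀ L x, 0 ≤ u L x)
    {α : Line t → Line t → ℝ} (hα : ∀ L L', 0 ≤ α L L')
    (hfact : ∀ x w, ∑ L, u L x * ∑ L', α L L' * lind L' w = (monoCount x w : ℝ)) :
    ∃ (σ : Equiv.Perm (Line t)) (c : Line t → Col t → ℝ), (∀ L x, 0 ≤ c L x) ∧
      ∀ L x w, u L x * ∑ L', α L L' * lind L' w = c L x * lind (σ L) w := by
  classical
  obtain ⟨-, σ, hσ⟩ := regroupingRigid ht hu hα hfact (by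
    simp only [Line, Fintype.card_sum, Fintype.card_prod, Fintype.card_fin]; nlinarith)
  refine ⟨σ, fun L x => u L x * α L (σ L), fun L x => mul_nonneg (hu L x) (hα L _), fun L x w => ?_⟩
  exact regroupingRigid_terms hα σ hσ L x w

/-- **Regrouping rigidity of the cheap corner of the triangle matrix, unconditionally** (registered sub-goal
`triangle_regrouping_rigidity` of stmt-PneNP-10680, verbatim signature, self-contained vocabulary): the statement of
`triangle_regrouping_rigidity_of_cov` WITHOUT its COV-rigidity hypothesis, for `t ≥ 4`. Rows `x` = three `2`-colourings of
`Fin t`; lines `(Fin t × Fin t) ⊕ (Fin t × Fin t) ⊕ (Fin t × Fin t)`; "`w ∈ L`" written out with `Sum.elim`. CONCLUSION: a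
non-negative factorisation of `M_t` with `R ≤ 3t²` terms whose column functions are non-negative combinations of line
indicators has `R = 3t²` and every generator supported on exactly one line, all lines distinct. -/
theorem triangle_regrouping_rigidity : ∀ (t R : ℕ), 4 ≤ t → ∀ (u : Fin R → (Fin t → Bool) × (Fin t → Bool) × (Fin t →
    Bool) → ℝ) (α : Fin R → (Fin t × Fin t) ⊕ (Fin t × Fin t) ⊕ (Fin t × Fin t) → ℝ), R ≤ 3 * t ^ 2 → (∀ i x, 0 ≤ u i
    x) → (∀ i L, 0 ≤ α i L) → (∀ (x : (Fin t → Bool) × (Fin t → Bool) × (Fin t → Bool)) (w : Fin t × Fin t × Fin t), ∑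
    i, u i x * ∑ L, α i L * Sum.elim (fun ab : Fin t × Fin t => if w.1 = ab.1 ∧ w.2.1 = ab.2 then (1 : ℝ) else 0)
    (Sum.elim (fun ad : Fin t × Fin t => if w.1 = ad.1 ∧ w.2.2 = ad.2 then (1 : ℝ) else 0) (fun bd : Fin t × Fin t =>
    if w.2.1 = bd.1 ∧ w.2.2 = bd.2 then (1 : ℝ) else 0)) L = ((if x.1 w.1 = x.2.1 w.2.1 then 1 else 0) + (if x.1 w.1 =
    x.2.2 w.2.2 then 1 else 0) + (if x.2.1 w.2.1 = x.2.2 w.2.2 then 1 else 0) : ℝ)) → R = 3 * t ^ 2 ∧ ∃ σ : Fin R ≃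
    ((Fin t × Fin t) ⊕ (Fin t × Fin t) ⊕ (Fin t × Fin t)), ∀ i L, 0 < α i L ↔ L = σ i := by
  intro t R ht u α hR hu hα hfact
  have hf : ∀ x w, ∑ i, u i x * ∑ L, α i L * lind L w = (monoCount x w : ℝ) := by
    intro x w
    rw [← sum_congr rfl fun i _ => by rw [← sum_congr rfl fun L _ => by rw [lind_eq_elim L w]], hfact x w]
    simp only [monoCount]; push_cast; ring
  obtain ⟨hcard, σ, hσ⟩ := regroupingRigid ht hu hα hf (by rw [Fintype.card_fin]; exact hR)
  rw [Fintype.card_fin] at hcard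
  exact ⟨hcard, σ, hσ⟩

end

end Summit.PneNP.PneNP.Theorems.XorDoor.TriLine
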